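/-
Copyright: the b2b-balaban T⁴-continuum CRUX team, row NE7b leaf lineage `t4-ne7b-formalise-leaf-02` (gen 134). Project licence.
-/
import Literature.MathematicalPhysics.QuantumFieldTheory.Balaban1983to89.B14TentUnityTorus
import Summits.QuantumFields.BalabanUV.T4Continuum.Spine.NE7b.TentUnityTorusSteps

/-!
# THE SUPPORT AND THE `ℓ²(cubes)` STEP LETTER OF THE CITED CIRCLE TENT: on `ℤ∕Nℤ`, `N = M·L`, with centres `bL + c` (`b ∈ ℤ∕Mℤ`), print's tent
# `h(a − (bL + c))` ([Balaban1988Convergent] (3.40) p. 275, `B14TentUnityTorus.tentZ`) is alive only for `b ∈ {q̄, q̄ + 1}`, `q = ⌊(a − c)∕L⌋` — so at most TWO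
# cubes are alive at a site — and the cubes alive at `a` or at `a + 1` lie in the SAME pair, so one lattice step moves the column `b ↦ h(a − (bL + c))` by at most
# `√2∕L` in `ℓ²(ℤ∕Mℤ)` (row NE7b, node U5c; residual (R2′) family (2), letter (ℓ1); kernel lemmas over a cited Literature object)

Cell `pub-balaban`, sub-cell `t4`, spine estimate NE7b (`T4WeightBudget.RelWeightBound`; the cell's OWN estimate — NOT PRINTED in [Bałaban 1983–89],
NOT PROVED).  Crux-route work under `Spine/NE7b/`; NOTHING of Bałaban's estimates is asserted; no `def`; zero `sorry`; no `T4Continuum/Support` leaf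
(FREEZE (0)).  Imports: `Literature.….B14TentUnityTorus` (`tentZ`, `tentZ_nonneg`, `sum_tentZ_sub_eq_one` — (3.40) on one discrete circle, the
indexing `a − (b.val·L + c)` of which is used VERBATIM here) and `…Spine.NE7b.TentUnityTorusSteps` (TZS, leaf-05 g157: `sq_tentZ_add_one_sub_le` —
`(h(u+1) − h(u))² ≤ 1∕L²`).

WHY.  The (h2) slot's partition input at k = 1 (`…AdmissibleFloorLinearPartition.ims_floor_of_linear_partition`, AFLP) wants, per axis of the torus,
the one-axis family `φ_b(a) := h(a − (bL + c))` with: `Σ_b φ_b(a) = 1` (`sum_tentZ_sub_eq_one`, cited), `0 ≤ φ ≤ 1`, AT MOST `μ₁` CUBES ALIVE AT A SITE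
(`…TentPartitionProduct.card_alive_prod_le_pow` then gives `μ₀ = μ₁^d`), and the ONE-STEP letter IN `ℓ²(cubes)` `Σ_b (φ_b(a+1) − φ_b(a))² ≤ η²`
(`…TentPartitionProduct.sum_sq_prod_update_sub_le` passes it to `d` axes with constant one; `…TentPartitionPath` ∕ `…PartitionPathLetters` turn it into
AFLP's `hvar` along chains).  TZS proves the POINTWISE step `|h(u+1) − h(u)| ≤ 1∕L`; the two letters above need the SUPPORT of the cited tent, which
`B14TentUnityTorus` does not state.  THIS FILE proves it: `μ₁ = 2` and `η² = 2∕L²` (so `Λ = N√2∕L` along `N` steps — no `2^d` in `Λ`).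
Dictionary with the NE7b usage: here `L` = the PARTITION scale (print's `M`-cubes of [B6] Sect. A ∕ SectE-interface-proof Prop. 5.6), `M` = the number of
cubes per axis, `N = M·L` = the sites per axis of the unit torus at k = 1 — the letters of `sum_tentZ_sub_eq_one`, kept so that the junction is BY NAME.

WHAT IS PROVED ([folklore]; `0 < L`, `N = M·L`, `c : ℕ` any offset, `q := (a − c).val ∕ L`):
* §1 `tentZ_le_one`; `abs_valMinAbs_lt_of_tentZ_ne_zero` (`h(u) ≠ 0 → |valMinAbs u| < L`).
* §2 THE INTEGER CORE `dvd_or_dvd_of_abs_lt` — if `ML ∣ v − b·L − m` with `|m| < L` then `M ∣ b − ⌊v∕L⌋`, or `M ∣ b − (⌊v∕L⌋ + 1)` and `L ∤ v`;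
  **`eq_or_eq_add_one_of_tentZ_ne_zero`** — `h(a − (bL + c)) ≠ 0 → b = q̄ ∨ (b = q̄ + 1 ∧ (a − c).val % L ≠ 0)`.
* §3 **`filter_tentZ_ne_zero_subset_pair`** (alive `⊆ {q̄, q̄ + 1}`), **`card_alive_tentZ_le_two`** — AFLP ∕ TPP's per-axis `hmult` with `μ₁ = 2`, in the
  `Finset.univ.filter (· ≠ 0)` shape they display.
* §4 the step: **`filter_tentZ_ne_zero_add_one_subset_pair`** — the cubes alive at `a + 1` lie in the pair OF `a` (three cases: inside a cube, entering the
  next cube, the wrap `val = N − 1 → 0`; `2 ≤ M`); **`sum_sq_tentZ_step_le`** — `Σ_b (h(a + 1 − (bL+c)) − h(a − (bL+c)))² ≤ 2∕L²` (vanishing off the pair +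
  TZS `sq_tentZ_add_one_sub_le` BY NAME on the two survivors).
* §5 toy: `M = 2`, `L = 1` (`N = 2`), `c = 0`: at most two cubes alive at any site (`example` via §3).

NOT HERE (honest): the `d`-axis product on the torus `Fin d → ZMod N` and the unit moves as `Function.update` (TPP's form), the chains of a term and AFLP's
four letters inhabited (the junction file `…TentPartitionTorus`, next), bonds vs sites; anything of Bałaban's estimates.
BY-NAME EFFECT ON THE WALL: NONE.  NE7b NOT PRINTED ∕ NOT PROVED; spine PROVED 0∕9; rung (B)+1 on ONE finite T⁴ — NOT infinite volume, NOT the mass gap, NOT Clay.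
HONEST DEPENDENCY: continuum YM on T⁴ ⇐ BetaPertH ∧ nine spine estimates (0/9 proved); BetaPertH ⇐ (D1) ∧ (D4) ∧ CAP+tail; G-an2-4 gates asym, D1 and NE2/3/4.
-/

set_option autoImplicit false

noncomputable section

open Finset
open Literature.MathematicalPhysics.QuantumFieldTheory.Balaban1983to89
open Literature.MathematicalPhysics.QuantumFieldTheory.Balaban1983to89.B14.TentUnityTorus (tentZ tentZ_nonneg)
open Summit.QuantumFields.BalabanUV.T4Continuum.NE7b.TentUnityTorusSteps (sq_tentZ_add_one_sub_le)

namespace Summit.QuantumFields.BalabanUV.T4Continuum.NE7b.TentUnityTorusSupport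

/-! ## §1 Values in `[0, 1]`; alive means circle distance `< L` -/

/-- `h(u) ≤ 1` on the circle (`h(t) = max{1 − |t|∕L, 0}`, `0 < L`). [folklore] -/
theorem tentZ_le_one {L : ℝ} (hL : 0 < L) {N : ℕ} (u : ZMod N) : tentZ L u ≤ 1 := by
  unfold tentZ B14Sect3.tent
  refine max_le ?_ zero_le_one
  have : 0 ≤ |((ZMod.valMinAbs u : ℤ) : ℝ)| / L := div_nonneg (abs_nonneg _) hL.le
  linarith

/-- Alive tents sit at circle distance `< L`: `h(u) ≠ 0 → |valMinAbs u| < L` (as integers). [folklore] -/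
theorem abs_valMinAbs_lt_of_tentZ_ne_zero {L : ℕ} (hL : 0 < L) {N : ℕ} {u : ZMod N} (h : tentZ (L : ℝ) u ≠ 0) :
    |(ZMod.valMinAbs u : ℤ)| < L := by
  have hLr : (0 : ℝ) < L := by exact_mod_cast hL
  have hlt : |((ZMod.valMinAbs u : ℤ) : ℝ)| < (L : ℝ) := by
    by_contra hle
    exact h (B14Sect3.tent_eq_zero_of_le (L : ℝ) _ hLr (not_lt.mp hle))
  rw [← Int.cast_abs] at hlt
  exact_mod_cast hlt

/-! ## §2 The integer core: an alive centre is `⌊v∕L⌋` or `⌊v∕L⌋ + 1` modulo `M` -/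

/-- THE INTEGER CORE.  If `M·L ∣ v − b·L − m` with `|m| < L` (`v, b : ℕ`, `m : ℤ`, `0 < L`), then `M ∣ b − ⌊v∕L⌋`, or `M ∣ b − (⌊v∕L⌋ + 1)` and `L ∤ v`:
writing `v = qL + r`, `L ∣ r − m ∈ (−L, 2L)`, so `r − m ∈ {0, L}`. [folklore] -/
theorem dvd_or_dvd_of_abs_lt {L M v b : ℕ} (hL : 0 < L) {m : ℤ} (hm : |m| < L)
    (hdvd : ((M * L : ℕ) : ℤ) ∣ (v : ℤ) - (b * L : ℕ) - m) :
    (M : ℤ) ∣ (b : ℤ) - (v / L : ℕ) ∨ ((M : ℤ) ∣ (b : ℤ) - ((v / L : ℕ) + 1) ∧ v % L ≠ 0) := by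
  have hvqr : v / L * L + v % L = v := Nat.div_add_mod' v L
  have hrlt : v % L < L := Nat.mod_lt v hL
  generalize v / L = q at hvqr ⊢
  generalize v % L = r at hvqr hrlt ⊢
  subst hvqr
  obtain ⟨k, hk⟩ := hdvd
  obtain ⟨hm1, hm2⟩ := abs_lt.mp hm
  have hLz : (0 : ℤ) < L := by exact_mod_cast hL
  have hrz : (r : ℤ) < L := by exact_mod_cast hrlt
  have hr0 : (0 : ℤ) ≤ r := by positivity
  -- `r − m = j·L` with `j := kM − q + b`
  have hjL : (r : ℤ) - m = (k * M - q + b) * L := by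
    push_cast at hk
    linear_combination hk
  generalize hj : k * M - q + b = j at hjL
  have hj0 : 0 ≤ j := by
    by_contra hneg
    have : j * (L : ℤ) ≤ -1 * L := mul_le_mul_of_nonneg_right (by omega) hLz.le
    linarith
  have hj1 : j ≤ 1 := by
    by_contra hbig
    have : 2 * (L : ℤ) ≤ j * L := mul_le_mul_of_nonneg_right (by omega) hLz.le
    linarith
  rcases (show j = 0 ∨ j = 1 by omega) with hj0' | hj1'
  · left
    subst hj0'
    exact ⟨-k, by linear_combination hj⟩
  · right
    subst hj1'
    refine ⟨⟨-k, by linear_combination hj⟩, ?_⟩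
    intro hr00
    subst hr00
    push_cast at hjL
    linarith

/-- **AN ALIVE CENTRE IS `q̄` OR `q̄ + 1`**: for `N = M·L`, `0 < L`, if `h(a − (b.val·L + c)) ≠ 0` then `b = q̄` or (`b = q̄ + 1` and `(a − c).val % L ≠ 0`), where
`q = (a − c).val ∕ L` (the representative `m = valMinAbs` of `a − c − b.val·L` has `|m| < L` and `N ∣ (a − c).val − b.val·L − m`). [folklore] -/
theorem eq_or_eq_add_one_of_tentZ_ne_zero (L M N : ℕ) [NeZero M] [NeZero N] (hL : 0 < L) (hN : N = M * L) (c : ℕ) (a : ZMod N) (b : ZMod M)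
    (h : tentZ (L : ℝ) (a - ((b.val * L + c : ℕ) : ZMod N)) ≠ 0) :
    b = (((a - (c : ZMod N)).val / L : ℕ) : ZMod M) ∨
      (b = (((a - (c : ZMod N)).val / L : ℕ) : ZMod M) + 1 ∧ (a - (c : ZMod N)).val % L ≠ 0) := by
  set w : ZMod N := a - (c : ZMod N) with hw
  have hrew : a - ((b.val * L + c : ℕ) : ZMod N) = w - ((b.val * L : ℕ) : ZMod N) := by
    rw [hw]; push_cast; ring
  rw [hrew] at h
  set m : ℤ := ZMod.valMinAbs (w - ((b.val * L : ℕ) : ZMod N)) with hm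
  have hmL : |m| < L := abs_valMinAbs_lt_of_tentZ_ne_zero hL h
  -- `N ∣ w.val − b.val·L − m`
  have hdvd : ((M * L : ℕ) : ℤ) ∣ (w.val : ℤ) - (b.val * L : ℕ) - m := by
    rw [← hN, ← ZMod.intCast_zmod_eq_zero_iff_dvd]
    push_cast
    rw [ZMod.natCast_zmod_val, hm, ZMod.coe_valMinAbs]
    push_cast
    ring
  have hbval : ((b.val : ℤ) : ZMod M) = b := by rw [Int.cast_natCast, ZMod.natCast_zmod_val]
  have hcore := dvd_or_dvd_of_abs_lt hL hmL hdvd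
  generalize w.val / L = q at hcore ⊢
  rcases hcore with h1 | ⟨h2, hr⟩
  · left
    have := (ZMod.intCast_eq_intCast_iff_dvd_sub (q : ℤ) (b.val : ℤ) M).mpr h1
    rw [hbval, Int.cast_natCast] at this
    exact this.symm
  · right
    refine ⟨?_, hr⟩
    have := (ZMod.intCast_eq_intCast_iff_dvd_sub ((q : ℤ) + 1) (b.val : ℤ) M).mpr h2
    rw [hbval] at this
    rw [← this]
    push_cast
    ring

/-! ## §3 At most two cubes alive at a site -/

/-- **THE ALIVE CUBES AT `a` LIE IN `{q̄, q̄ + 1}`**, `q = (a − c).val ∕ L`. [folklore] -/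
theorem filter_tentZ_ne_zero_subset_pair (L M N : ℕ) [NeZero M] [NeZero N] (hL : 0 < L) (hN : N = M * L) (c : ℕ) (a : ZMod N) :
    (Finset.univ.filter fun b : ZMod M => tentZ (L : ℝ) (a - ((b.val * L + c : ℕ) : ZMod N)) ≠ 0)
      ⊆ {(((a - (c : ZMod N)).val / L : ℕ) : ZMod M), (((a - (c : ZMod N)).val / L : ℕ) : ZMod M) + 1} := by
  intro b hb
  rw [Finset.mem_filter] at hb
  rw [Finset.mem_insert, Finset.mem_singleton]
  rcases eq_or_eq_add_one_of_tentZ_ne_zero L M N hL hN c a b hb.2 with h | ⟨h, _⟩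
  · exact Or.inl h
  · exact Or.inr h

/-- **AT MOST TWO CUBES ALIVE AT A SITE**: `#{b : h(a − (b.val·L + c)) ≠ 0} ≤ 2` — the per-axis multiplicity `μ₁ = 2` of AFLP ∕ TPP's `hmult`. [folklore] -/
theorem card_alive_tentZ_le_two (L M N : ℕ) [NeZero M] [NeZero N] (hL : 0 < L) (hN : N = M * L) (c : ℕ) (a : ZMod N) :
    (Finset.univ.filter fun b : ZMod M => tentZ (L : ℝ) (a - ((b.val * L + c : ℕ) : ZMod N)) ≠ 0).card ≤ 2 :=
  (Finset.card_le_card (filter_tentZ_ne_zero_subset_pair L M N hL hN c a)).trans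
    ((Finset.card_insert_le _ _).trans (by simp))

/-! ## §4 One lattice step: the alive cubes at `a + 1` lie in the pair of `a`; the `ℓ²(cubes)` step letter -/

/-- **THE CUBES ALIVE AT `a + 1` LIE IN THE PAIR OF `a`**: `{b : h(a + 1 − (b.val·L + c)) ≠ 0} ⊆ {q̄, q̄ + 1}` with `q = (a − c).val ∕ L` (NOT `(a + 1 − c).val ∕ L`):
inside a cube the quotient is unchanged; entering the next cube (`(a − c).val % L = L − 1`) only the centre `q̄ + 1` is alive at `a + 1` (remainder `0`); at the
wrap `(a − c).val = N − 1` the only alive centre is `0̄ = q̄ + 1` (`q = M − 1`).  Needs `2 ≤ M` (so `2 ≤ N` and `val 1 = 1`). [folklore] -/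
theorem filter_tentZ_ne_zero_add_one_subset_pair (L M N : ℕ) [NeZero M] [NeZero N] (hL : 0 < L) (hM : 2 ≤ M) (hN : N = M * L) (c : ℕ)
    (a : ZMod N) :
    (Finset.univ.filter fun b : ZMod M => tentZ (L : ℝ) (a + 1 - ((b.val * L + c : ℕ) : ZMod N)) ≠ 0)
      ⊆ {(((a - (c : ZMod N)).val / L : ℕ) : ZMod M), (((a - (c : ZMod N)).val / L : ℕ) : ZMod M) + 1} := by
  intro b hb
  rw [Finset.mem_filter] at hb
  rw [Finset.mem_insert, Finset.mem_singleton]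
  have hML : 2 * 1 ≤ M * L := Nat.mul_le_mul hM hL
  have hN2 : 1 < N := by rw [hN]; omega
  haveI : Fact (1 < N) := ⟨hN2⟩
  set w : ZMod N := a - (c : ZMod N) with hw
  have hw1 : a + 1 - (c : ZMod N) = w + 1 := by rw [hw]; ring
  -- the core lemma at `a + 1`, read through `(w + 1).val = (w.val + 1) mod N`
  have hcore := eq_or_eq_add_one_of_tentZ_ne_zero L M N hL hN c (a + 1) b hb.2
  rw [hw1, ZMod.val_add, ZMod.val_one] at hcore
  have hwlt : w.val < N := ZMod.val_lt w
  generalize hv : w.val = v at hcore hwlt ⊢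
  rcases Nat.lt_or_ge (v + 1) N with hlt | hge
  · -- no wrap: `(w + 1).val = v + 1`
    rw [Nat.mod_eq_of_lt hlt] at hcore
    by_cases hd : L ∣ v + 1
    · -- entering the next cube: quotient `q + 1`, remainder `0` — only `q̄ + 1` survives
      rw [Nat.succ_div_of_dvd hd, Nat.mod_eq_zero_of_dvd hd] at hcore
      rcases hcore with h | ⟨_, hne⟩
      · right; rw [h]; push_cast; ring
      · exact absurd rfl hne
    · -- inside a cube: same quotient
      rw [Nat.succ_div_of_not_dvd hd] at hcore
      rcases hcore with h | ⟨h, _⟩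
      · exact Or.inl h
      · exact Or.inr h
  · -- the wrap: `v + 1 = N`, `(w + 1).val = 0`, and `v ∕ L = M − 1`
    have hvN : v + 1 = N := by omega
    rw [hvN, Nat.mod_self, Nat.zero_div, Nat.zero_mod] at hcore
    have hq : v / L = M - 1 := by
      have hsub : (M - 1) * L = M * L - L := Nat.sub_one_mul M L
      refine Nat.div_eq_of_lt_le ?_ ?_
      · omega
      · rw [Nat.sub_add_cancel (by omega : 1 ≤ M)]; omega
    rcases hcore with h | ⟨_, hne⟩
    · right
      rw [h, hq, Nat.cast_zero]
      have h1 : (((M - 1 : ℕ) : ZMod M)) + 1 = ((M - 1 + 1 : ℕ) : ZMod M) := by push_cast; ring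
      rw [h1, Nat.sub_add_cancel (by omega : 1 ≤ M), ZMod.natCast_self]
    · exact absurd rfl hne

/-- **THE `ℓ²(cubes)` STEP LETTER OF THE CITED TENT**: `Σ_b (h(a + 1 − (b.val·L + c)) − h(a − (b.val·L + c)))² ≤ 2∕L²` (`0 < L`, `2 ≤ M`, `N = M·L`): the summand
vanishes off the pair `{q̄, q̄ + 1}` of `a` (§3, §4) and each survivor is `≤ 1∕L²` by `TentUnityTorusSteps.sq_tentZ_add_one_sub_le`. [folklore] -/
theorem sum_sq_tentZ_step_le (L M N : ℕ) [NeZero M] [NeZero N] (hL : 0 < L) (hM : 2 ≤ M) (hN : N = M * L) (c : ℕ) (a : ZMod N) :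
    ∑ b : ZMod M, (tentZ (L : ℝ) (a + 1 - ((b.val * L + c : ℕ) : ZMod N)) - tentZ (L : ℝ) (a - ((b.val * L + c : ℕ) : ZMod N))) ^ 2
      ≤ 2 / (L : ℝ) ^ 2 := by
  classical
  have hLr : (0 : ℝ) < L := by exact_mod_cast hL
  have hN2 : 2 ≤ N := by
    rw [hN]; calc 2 = 2 * 1 := by norm_num
      _ ≤ M * L := Nat.mul_le_mul hM hL
  set P : Finset (ZMod M) :=
    {(((a - (c : ZMod N)).val / L : ℕ) : ZMod M), (((a - (c : ZMod N)).val / L : ℕ) : ZMod M) + 1} with hP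
  -- off the pair both tents vanish
  have hvan : ∀ b, b ∉ P →
      (tentZ (L : ℝ) (a + 1 - ((b.val * L + c : ℕ) : ZMod N)) - tentZ (L : ℝ) (a - ((b.val * L + c : ℕ) : ZMod N))) ^ 2 = 0 := by
    intro b hb
    have h0 : tentZ (L : ℝ) (a - ((b.val * L + c : ℕ) : ZMod N)) = 0 := by
      by_contra hne
      exact hb (filter_tentZ_ne_zero_subset_pair L M N hL hN c a (Finset.mem_filter.mpr ⟨Finset.mem_univ _, hne⟩))
    have h1 : tentZ (L : ℝ) (a + 1 - ((b.val * L + c : ℕ) : ZMod N)) = 0 := by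
      by_contra hne
      exact hb (filter_tentZ_ne_zero_add_one_subset_pair L M N hL hM hN c a (Finset.mem_filter.mpr ⟨Finset.mem_univ _, hne⟩))
    rw [h0, h1, sub_zero, zero_pow two_ne_zero]
  rw [← Finset.sum_subset (Finset.subset_univ P) fun b _ hb => hvan b hb]
  -- each survivor is `≤ 1∕L²` (TZS)
  have hterm : ∀ b : ZMod M,
      (tentZ (L : ℝ) (a + 1 - ((b.val * L + c : ℕ) : ZMod N)) - tentZ (L : ℝ) (a - ((b.val * L + c : ℕ) : ZMod N))) ^ 2 ≤ 1 / (L : ℝ) ^ 2 := by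
    intro b
    have heq : a + 1 - ((b.val * L + c : ℕ) : ZMod N) = a - ((b.val * L + c : ℕ) : ZMod N) + 1 := by ring
    rw [heq]
    exact sq_tentZ_add_one_sub_le hLr hN2 _
  calc ∑ b ∈ P, (tentZ (L : ℝ) (a + 1 - ((b.val * L + c : ℕ) : ZMod N)) - tentZ (L : ℝ) (a - ((b.val * L + c : ℕ) : ZMod N))) ^ 2
      ≤ ∑ _b ∈ P, 1 / (L : ℝ) ^ 2 := Finset.sum_le_sum fun b _ => hterm b
    _ = P.card * (1 / (L : ℝ) ^ 2) := by rw [Finset.sum_const, nsmul_eq_mul]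
    _ ≤ 2 * (1 / (L : ℝ) ^ 2) := by
        refine mul_le_mul_of_nonneg_right ?_ (by positivity)
        exact_mod_cast (Finset.card_insert_le _ _).trans (by simp)
    _ = 2 / (L : ℝ) ^ 2 := by ring

/-! ## §5 Toy: two cubes of one site each -/

/- `M = 2`, `L = 1`, `N = 2`, `c = 0`: at most two cubes alive at any site of `ℤ∕2ℤ`. -/
example (a : ZMod 2) :
    (Finset.univ.filter fun b : ZMod 2 => tentZ ((1 : ℕ) : ℝ) (a - ((b.val * 1 + 0 : ℕ) : ZMod 2)) ≠ 0).card ≤ 2 :=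
  card_alive_tentZ_le_two 1 2 2 one_pos rfl 0 a

end Summit.QuantumFields.BalabanUV.T4Continuum.NE7b.TentUnityTorusSupport

end
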